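import Summits.Ventures.YMGap.Thresholds.StarReceivedSum
import HarnessLib

/-!
# Venture YMGap — track (c) «DS», the vertex-STAR window: the influence ARRAY by position, the
# resolvent identities of the star's Dobrushin matrix, and «received sum = starR»

HONEST FRAMING: venture file (cell `pub-ymgap`), strong-coupling LATTICE bookkeeping only (currency
SC-a); PURE REAL ARITHMETIC, companion of `StarReceivedSum.lean`.  The cell's Lemma S
(`STAR-PROOF.md` P5–P6, pen-and-paper, class A, referee-audited) bounds the Kantorovich response of
the star window kernel to a boundary link `y` of the plaquette `p_ab` by an array `k(y → x)` that
depends only on the POSITION of the star link `x` relative to the ordered pair `(a, b)`: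
`x ∈ {a, b}` (an END of the perturbed pair), `x ∈ {ā, b̄}` (OPPOSITE to an end), or generic
(adjacent to both). This file

* records the entries `d₀, d₁, d₂` of `D = (I − C̄)⁻¹` for the star's internal Dobrushin matrix
  `C̄ = c(J − I − M)` (8 links, `M` = the opposite-link matching) and PROVES the resolvent identities
  `(I − C̄)D = I` row by row (`resolvent_diag`, `resolvent_adj`, `resolvent_opp`) — so the closed
  form does not rest on an unverified spectral computation;
* defines the three array values `kEnd`, `kOpp`, `kGen` of Lemma S (the `(S_a)/(S_b)`-averaged
  coefficients, `STAR-PROOF.md` P6) as functions of `(β, τ₅, κ_q, Λ₃)`;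
* proves the **received-sum identity** `12·kEnd + 12·kOpp + 24·kGen = starR β τ₅ κ_q Λ₃`
  (`receivedSum_eq_starR`): a star link is an end for 12 boundary links, opposite-to-an-end for 12,
  generic for 24 (= 48 boundary links of a star) — the counting itself is lattice geometry and is
  NOT done here (it is the window-system side, `StarWindow`);
* proves the array is nonnegative for `0 ≤ β < 2/3` and nonnegative constants (`kGen_nonneg`,
  `kOpp_nonneg`, `kEnd_nonneg`), as the certificate format `DSWindow.Certificate.k_nonneg` requires.

WHAT THIS IS NOT: no claim that the array bounds the star kernel (that is Lemma S, not asserted in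
Lean); no lattice geometry; nothing about confinement, the continuum or the mass gap.

References: `STAR-PROOF.md` P6 (cell file); H. Föllmer, LNM 1362 (1988) Ch. I (2.8) (the matrix
`D = ∑ Cⁿ`); R. L. Dobrushin, S. B. Shlosman (1985).
-/

noncomputable section

namespace Summit.Ventures.YMGap.StarWindow

/-! ### The resolvent of the star's Dobrushin matrix -/

/-- Diagonal entry `d₀ = u/8 + 3v/8 + 1/2` of `D = (I − c(J − I − M))⁻¹`. [folklore] -/
def d0 (c : ℝ) : ℝ := u c / 8 + 3 * v c / 8 + 1 / 2

/-- Entry `d₁ = (u − v)/8` of `D` between ADJACENT star links (sharing a plaquette). [folklore] -/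
def d1 (c : ℝ) : ℝ := (u c - v c) / 8

/-- Entry `d₂ = u/8 + 3v/8 − 1/2` of `D` between OPPOSITE star links. [folklore] -/
def d2 (c : ℝ) : ℝ := u c / 8 + 3 * v c / 8 - 1 / 2

/-- `E₁ = u − d₀ − d₂` (`= 6cuv`): the `D`-row sum over the partners of `a`, read at `a` or `ā`.
[folklore] -/
def E1 (c : ℝ) : ℝ := 6 * c * u c * v c

/-- `E₂ = u − 2d₁` (`= (3u + v)/4`): the `D`-row sum over the partners of `a`, read at a link
adjacent to `a`. [folklore] -/
def E2 (c : ℝ) : ℝ := (3 * u c + v c) / 4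

/-- `u·(1 − 6c) = 1` for `6c ≠ 1`. [folklore] -/
theorem u_mul {c : ℝ} (h1 : 1 - 6 * c ≠ 0) : u c * (1 - 6 * c) = 1 := by
  unfold u; exact one_div_mul_cancel h1

/-- `v·(1 + 2c) = 1` for `1 + 2c ≠ 0`. [folklore] -/
theorem v_mul {c : ℝ} (h2 : 1 + 2 * c ≠ 0) : v c * (1 + 2 * c) = 1 := by
  unfold v; exact one_div_mul_cancel h2

/-- **Resolvent identity, diagonal row**: `d₀ − 6c·d₁ = 1` (entry `(a,a)` of `(I − C̄)D = I`: the
six partners of `a` all sit at `D`-distance `d₁` from `a`), for `6c ≠ 1`, `1 + 2c ≠ 0`. [folklore] -/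
theorem resolvent_diag {c : ℝ} (h1 : 1 - 6 * c ≠ 0) (h2 : 1 + 2 * c ≠ 0) :
    d0 c - 6 * c * d1 c = 1 := by
  unfold d0 d1
  linear_combination (1 / 8 : ℝ) * u_mul h1 + (3 / 8 : ℝ) * v_mul h2

/-- **Resolvent identity, adjacent row**: `d₁ − c(d₀ + d₂ + 4d₁) = 0` (entry `(a,b)`, `b ∼ a`: the
partners of `a` are `b` itself, `b̄`, and four links adjacent to `b`). [folklore] -/
theorem resolvent_adj {c : ℝ} (h1 : 1 - 6 * c ≠ 0) (h2 : 1 + 2 * c ≠ 0) :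
    d1 c - c * (d0 c + d2 c + 4 * d1 c) = 0 := by
  unfold d0 d1 d2
  linear_combination (1 / 8 : ℝ) * u_mul h1 - (1 / 8 : ℝ) * v_mul h2

/-- **Resolvent identity, opposite row**: `d₂ − 6c·d₁ = 0` (entry `(a,ā)`: every partner of `a` is
adjacent to `ā`). [folklore] -/
theorem resolvent_opp {c : ℝ} (h1 : 1 - 6 * c ≠ 0) (h2 : 1 + 2 * c ≠ 0) :
    d2 c - 6 * c * d1 c = 0 := by
  unfold d1 d2
  linear_combination (1 / 8 : ℝ) * u_mul h1 + (3 / 8 : ℝ) * v_mul h2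

/-- Row sum of `D`: `d₀ + 6d₁ + d₂ = u = 1/(1 − 6c)`. [folklore] -/
theorem resolvent_rowsum (c : ℝ) : d0 c + 6 * d1 c + d2 c = u c := by
  unfold d0 d1 d2
  ring

/-- `E₁ = u − d₀ − d₂` (uses `u − v = 8c·u·v`). [folklore] -/
theorem E1_eq {c : ℝ} (h1 : 1 - 6 * c ≠ 0) (h2 : 1 + 2 * c ≠ 0) : E1 c = u c - d0 c - d2 c := by
  unfold E1 d0 d2
  linear_combination (-(3 / 4 : ℝ) * v c) * u_mul h1 + ((3 / 4 : ℝ) * u c) * v_mul h2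

/-- `E₂ = u − 2d₁`. [folklore] -/
theorem E2_eq (c : ℝ) : E2 c = u c - 2 * d1 c := by
  unfold E2 d1
  ring

/-! ### The array of Lemma S by position -/

/-- `k(y → x)` for `x` an END of the perturbed pair (`x = a` or `x = b`): the average of the
`(S_a)`-coefficients at `x = a` (`c + c[(B−P)E₂ + 6PE₂]`) and at `x = b` (`(B−P)d₀ + PE₂`).
[folklore] -/
def kEnd (β τ₅ κq Λ₃ : ℝ) : ℝ :=
  ((β / 4) + (β / 4) * ((Bcoef β τ₅ κq Λ₃ - Pcoef β Λ₃) * E2 (β / 4) + 6 * Pcoef β Λ₃ * E2 (β / 4)) +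
    ((Bcoef β τ₅ κq Λ₃ - Pcoef β Λ₃) * d0 (β / 4) + Pcoef β Λ₃ * E2 (β / 4))) / 2

/-- `k(y → x)` for `x` OPPOSITE to an end (`x = ā` or `x = b̄`): the average of `(B−P)d₁ + PE₁`
and `(B−P)d₂ + PE₂`. [folklore] -/
def kOpp (β τ₅ κq Λ₃ : ℝ) : ℝ :=
  (((Bcoef β τ₅ κq Λ₃ - Pcoef β Λ₃) * d1 (β / 4) + Pcoef β Λ₃ * E1 (β / 4)) +
    ((Bcoef β τ₅ κq Λ₃ - Pcoef β Λ₃) * d2 (β / 4) + Pcoef β Λ₃ * E2 (β / 4))) / 2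

/-- `k(y → x)` for `x` in GENERIC position (adjacent to both ends): `(B−P)d₁ + PE₂`. [folklore] -/
def kGen (β τ₅ κq Λ₃ : ℝ) : ℝ :=
  (Bcoef β τ₅ κq Λ₃ - Pcoef β Λ₃) * d1 (β / 4) + Pcoef β Λ₃ * E2 (β / 4)

/-- **Received-sum identity**: with 12 boundary links seeing `x` as an end, 12 as opposite to an
end and 24 in generic position, `12·kEnd + 12·kOpp + 24·kGen = starR` (`STAR-PROOF.md` (P6.1)),
(a polynomial identity in `u, v, c, B, P`). [folklore] -/
theorem receivedSum_eq_starR (β τ₅ κq Λ₃ : ℝ) :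
    12 * kEnd β τ₅ κq Λ₃ + 12 * kOpp β τ₅ κq Λ₃ + 24 * kGen β τ₅ κq Λ₃ = starR β τ₅ κq Λ₃ := by
  unfold kEnd kOpp kGen starR Phi1 Phi2 d0 d1 d2 E1 E2
  ring

/-! ### Nonnegativity of the array -/

/-- `d₁ ≥ 0` for `0 ≤ c < 1/6` (`u ≥ 1 ≥ v`). [folklore] -/
theorem d1_nonneg {c : ℝ} (h0 : 0 ≤ c) (hc : 6 * c < 1) : 0 ≤ d1 c := by
  unfold d1 u v
  have hu : 1 ≤ 1 / (1 - 6 * c) := by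
    rw [le_div_iff₀ (by linarith)]; linarith
  have hv : 1 / (1 + 2 * c) ≤ 1 := by
    rw [div_le_iff₀ (by linarith)]; linarith
  linarith

/-- `d₂ ≥ 0` for `0 ≤ c < 1/6` (`u + 3v − 4 = 48c²/((1 − 6c)(1 + 2c)) ≥ 0`). [folklore] -/
theorem d2_nonneg {c : ℝ} (h0 : 0 ≤ c) (hc : 6 * c < 1) : 0 ≤ d2 c := by
  unfold d2 u v
  have ha : 0 < 1 - 6 * c := by linarith
  have hb : 0 < 1 + 2 * c := by linarith
  have key : 1 / (1 - 6 * c) + 3 * (1 / (1 + 2 * c)) - 4 = 48 * c ^ 2 / ((1 - 6 * c) * (1 + 2 * c)) := by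
    field_simp
    ring
  have hk : 0 ≤ 48 * c ^ 2 / ((1 - 6 * c) * (1 + 2 * c)) := by positivity
  linarith

/-- `d₀ ≥ 0` for `0 ≤ c < 1/6`. [folklore] -/
theorem d0_nonneg {c : ℝ} (h0 : 0 ≤ c) (hc : 6 * c < 1) : 0 ≤ d0 c := by
  have h := d2_nonneg h0 hc
  unfold d2 at h
  unfold d0
  linarith

/-- `E₁ ≥ 0` for `0 ≤ c < 1/6`. [folklore] -/
theorem E1_nonneg {c : ℝ} (h0 : 0 ≤ c) (hc : 6 * c < 1) : 0 ≤ E1 c := by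
  unfold E1
  have hu := u_pos hc
  have hv := v_pos h0
  positivity

/-- `E₂ ≥ 0` for `0 ≤ c < 1/6`. [folklore] -/
theorem E2_nonneg {c : ℝ} (h0 : 0 ≤ c) (hc : 6 * c < 1) : 0 ≤ E2 c := by
  unfold E2
  have hu := u_pos hc
  have hv := v_pos h0
  positivity

/-- `P ≥ 0` for `β, Λ₃ ≥ 0`. [folklore] -/
theorem Pcoef_nonneg {β Λ₃ : ℝ} (h0 : 0 ≤ β) (hΛ : 0 ≤ Λ₃) : 0 ≤ Pcoef β Λ₃ := by
  unfold Pcoef; positivity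

/-- `B − P ≥ 0` for `0 ≤ β`, `β/16 ≤ τ₅` is NOT needed: `B − P = βτ₅/4 + κ_qβ²/4 − β²/16 + β³Λ₃/6`,
nonnegative as soon as `τ₅, Λ₃ ≥ 0` and `κ_q ≥ 1/4`. [folklore] -/
theorem Bcoef_sub_Pcoef_nonneg {β τ₅ κq Λ₃ : ℝ} (h0 : 0 ≤ β) (hτ : 0 ≤ τ₅) (hκ : 1 / 4 ≤ κq)
    (hΛ : 0 ≤ Λ₃) : 0 ≤ Bcoef β τ₅ κq Λ₃ - Pcoef β Λ₃ := by
  unfold Bcoef Pcoef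
  have h1 : 0 ≤ β * τ₅ / 4 := by positivity
  have h2 : 0 ≤ β ^ 3 * Λ₃ := by positivity
  have h3 : β * (β / 4) / 4 ≤ κq * β * (β / 4) := by nlinarith
  nlinarith

/-- The generic entry is nonnegative (`0 ≤ β < 2/3`, `τ₅, Λ₃ ≥ 0`, `κ_q ≥ 1/4`). [folklore] -/
theorem kGen_nonneg {β τ₅ κq Λ₃ : ℝ} (h0 : 0 ≤ β) (h23 : β < 2 / 3) (hτ : 0 ≤ τ₅)
    (hκ : 1 / 4 ≤ κq) (hΛ : 0 ≤ Λ₃) : 0 ≤ kGen β τ₅ κq Λ₃ := by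
  unfold kGen
  have hc0 : 0 ≤ β / 4 := by positivity
  have hc1 : 6 * (β / 4) < 1 := by linarith
  have := Bcoef_sub_Pcoef_nonneg h0 hτ hκ hΛ
  have := Pcoef_nonneg h0 hΛ
  have := d1_nonneg hc0 hc1
  have := E2_nonneg hc0 hc1
  positivity

/-- The opposite entry is nonnegative (same hypotheses). [folklore] -/
theorem kOpp_nonneg {β τ₅ κq Λ₃ : ℝ} (h0 : 0 ≤ β) (h23 : β < 2 / 3) (hτ : 0 ≤ τ₅)
    (hκ : 1 / 4 ≤ κq) (hΛ : 0 ≤ Λ₃) : 0 ≤ kOpp β τ₅ κq Λ₃ := by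
  unfold kOpp
  have hc0 : 0 ≤ β / 4 := by positivity
  have hc1 : 6 * (β / 4) < 1 := by linarith
  have := Bcoef_sub_Pcoef_nonneg h0 hτ hκ hΛ
  have := Pcoef_nonneg h0 hΛ
  have := d1_nonneg hc0 hc1
  have := d2_nonneg hc0 hc1
  have := E1_nonneg hc0 hc1
  have := E2_nonneg hc0 hc1
  positivity

/-- The end entry is nonnegative (same hypotheses). [folklore] -/
theorem kEnd_nonneg {β τ₅ κq Λ₃ : ℝ} (h0 : 0 ≤ β) (h23 : β < 2 / 3) (hτ : 0 ≤ τ₅)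
    (hκ : 1 / 4 ≤ κq) (hΛ : 0 ≤ Λ₃) : 0 ≤ kEnd β τ₅ κq Λ₃ := by
  unfold kEnd
  have hc0 : 0 ≤ β / 4 := by positivity
  have hc1 : 6 * (β / 4) < 1 := by linarith
  have := Bcoef_sub_Pcoef_nonneg h0 hτ hκ hΛ
  have := Pcoef_nonneg h0 hΛ
  have := d0_nonneg hc0 hc1
  have := E2_nonneg hc0 hc1
  positivity

end Summit.Ventures.YMGap.StarWindow

end
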